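import Summits.RiemannHypothesis.RiemannHypothesis.Theorems.Splittings.LiIncrEnvelope
import Summits.RiemannHypothesis.RiemannHypothesis.Theorems.Splittings.LiCurvatureSignChangesRH
import Summits.RiemannHypothesis.RiemannHypothesis.Theorems.Splittings.LiDifferenceOrderLaw
import HarnessLib

/-!
# The TURÁN–CURVATURE COUPLING LAW for the Keiper–Li coefficients under RH (SketchG11 §4)

Cell rh-split, seat rh-split-li-bridge g11 (brief sha16 f79c5f09d8bcb036), card `run/shared/lean/pub/rh-split/cards/SPLIT-li-bridge.md` §18;
kernel source `HOME/rh-split-li-bridge/SketchG11.lean` sha16 f517e835010cd3f4 (726 l, farm rc 0 · 0 err · 0 warn · 0 sorry, std axioms), cut by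
the seat at the scratch's section boundaries (§§1–2 / §3 / §4), decl text byte-verbatim; deltas = namespace `RhSplit.LiBridgeG11` ↦
`…Theorems.Splittings.LiIncrEnvelope`, imports, module docstrings, `open` lists trimmed to the imported namespaces.

Write `λ_n = keiperLiCoeff n`, `Δ_n = λ_{n+1} − λ_n`, `d_n = λ_{n+2} − 2λ_{n+1} + λ_n`, `T_{n+1} = λ_{n+1}² − λ_nλ_{n+2} = −λ_{n+1}d_n + Δ_nΔ_{n+1}`.
Inputs: this cut's `abs_liIncr_le_of_rh` (`|Δ_n| ≤ C log² n` under RH), the tree's `Voros2006_thm_onlyif_holds` (`n/2 ≤ λ_n ≤ n/2·(log n+1)`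
eventually under RH; private `li_lower_of_rh`, same derivation as `LiTuranLawRH.li_linear_bounds_of_rh`), `LiCurvatureSignChanges.
liSecondDiff_two_signs_of_rh` (`d_n ≥ η` and `≤ −η` in every window under RH), `LiSecondOrderCriterion.abs_liSecondDiff_le_of_rh`, and the
pure counting helper `LiDifferenceOrderLaw.card_filter_range_ge_div`.
* `abs_turan_add_main_le_of_rh` (RH ⟹): eventually `|T_{n+1} + λ_{n+1} d_n| ≤ C log⁴(n+1)` — the Turán determinant is `−λ_{n+1}d_n` up to
  a poly-log error while `λ_{n+1} ≍ n log n`;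
* `tendsto_turan_ratio_add_secondDiff_of_rh` (RH ⟹): `T_{n+1}/λ_{n+1} + d_n → 0` (the SIGN LAW: `sign T_{n+1} = −sign d_n` wherever `|d_n|`
  is not tiny; numerically `98.9 %` of `n ≤ 10⁵`, card §17.2);
* `turanFail_syndetic_of_rh` (RH ⟹): `T_{n+1} < 0` in EVERY window `[N, N+L)`, `N ≥ n₀` — upgrades `LiTuranLawRH.turanFail_io_of_rh`
  (infinitely often) to BOUNDED GAPS; `turan_both_signs_syndetic_of_rh`; `turan_sign_sets_lower_density_of_rh`: both Turán sign sets
  have lower density `≥ 1/L`.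
Zero definitions; standard axioms.

HONEST LABEL: «SPLITTING SEARCH over kernel-typed RH-EQUIVALENCES; a splitting A ∧ B ⟹ RH is CONDITIONAL bookkeeping unless A and B are
both proved; nothing here bears on the truth of RH.»  Every theorem below is an RH-CONSEQUENCE (`RiemannHypothesis → …`); none is an RH-equivalence and none is a claim about RH.
-/

set_option linter.dupNamespace false

noncomputable section

namespace Summit.RiemannHypothesis.RiemannHypothesis.Theorems.Splittings.LiIncrEnvelope

open Filter Topology Finset Set MeasureTheory Asymptotics
open scoped Real
open Literature.NumberTheory.LFunctions Literature.NumberTheory.LFunctions.SchoenfeldBound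
open Literature.NumberTheory.DiophantineGeometry
open Summit.RiemannHypothesis.RiemannHypothesis.Theorems.LiTheory
open Summit.RiemannHypothesis.RiemannHypothesis.Theorems.LiTheory.SmoothReplace
open Summit.RiemannHypothesis.RiemannHypothesis.Theorems.LiTheory.Window
open Summit.RiemannHypothesis.RiemannHypothesis.Theorems.Splittings
open Summit.RiemannHypothesis.RiemannHypothesis.Theorems.Splittings.LiIncrHighPart
open Summit.RiemannHypothesis.RiemannHypothesis.Theorems.Splittings.LiCurvatureSignChanges

/-! ## §4 The Turán sign law under RH: `T_{n+1} = −λ_{n+1} d_n + O(log⁴ n)`, both Turán signs syndetic -/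

/-- Under RH, beyond a threshold `n/2 ≤ λ_n` (Voros's asymptotic `λ_n = ½n(log n − 1 + γ − log 2π) + o(n)`, tree fact
`Voros2006_thm_onlyif_holds`, at `ε = ½`; same derivation as SketchG10 §1, lower half only). -/
private theorem li_lower_of_rh (hRH : _root_.RiemannHypothesis) :
    ∃ N₁ : ℕ, ∀ n : ℕ, N₁ ≤ n → (n : ℝ) / 2 ≤ keiperLiCoeff n := by
  have hV := (Voros2006_thm_onlyif_holds hRH).def (show (0 : ℝ) < 1 / 2 by norm_num)
  obtain ⟨N, hN⟩ := eventually_atTop.1 (hV.and (eventually_ge_atTop (2 ^ 14)))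
  refine ⟨N, fun n hn ↦ ?_⟩
  obtain ⟨hb, hn14⟩ := hN n hn
  have hn14' : (2 : ℝ) ^ 14 ≤ n := by exact_mod_cast hn14
  have hlog2 : (0.6931471803 : ℝ) < Real.log 2 := Real.log_two_gt_d9
  have hlogn : Real.log ((2 : ℝ) ^ 14) ≤ Real.log n := Real.log_le_log (by positivity) hn14'
  rw [Real.log_pow] at hlogn
  push_cast at hlogn
  have hγ : (1 : ℝ) / 2 < Real.eulerMascheroniConstant := Real.one_half_lt_eulerMascheroniConstant
  have hlog2π : Real.log (2 * Real.pi) ≤ 2 * Real.pi - 1 := Real.log_le_sub_one_of_pos (by positivity)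
  have hπ : Real.pi ≤ 4 := Real.pi_le_four
  have hbr : 2 ≤ Real.log n - 1 + Real.eulerMascheroniConstant - Real.log (2 * Real.pi) := by linarith
  rw [Real.norm_eq_abs, Real.norm_eq_abs, Nat.abs_cast] at hb
  obtain ⟨h1, h2⟩ := abs_le.1 hb
  have hn0 : (0 : ℝ) ≤ n := Nat.cast_nonneg n
  nlinarith

/-- The Turán identity `b² − ac = −b(c − 2b + a) + (b − a)(c − b)`, i.e. `T_{n+1} = −λ_{n+1} d_n + Δ_n Δ_{n+1}`. -/
private theorem turan_identity (a b c : ℝ) :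
    b ^ 2 - a * c = -(b * (c - 2 * b + a)) + (b - a) * (c - b) := by
  ring

/-- Under RH, `|Δ_n Δ_{n+1}| ≤ C² log⁴(n+1)` for all large `n`. -/
private theorem abs_incrProd_le_of_rh (hRH : _root_.RiemannHypothesis) :
    ∃ C : ℝ, 0 < C ∧ ∀ᶠ n : ℕ in atTop,
      |liIncr n * liIncr (n + 1)| ≤ C * Real.log ((n : ℝ) + 1) ^ 4 := by
  obtain ⟨C, hC0, hC⟩ := abs_liIncr_le_of_rh hRH
  refine ⟨C ^ 2, by positivity, ?_⟩
  filter_upwards [hC, (tendsto_add_atTop_nat 1).eventually hC, eventually_ge_atTop 1] with n hn hn' h1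
  push_cast at hn'
  have hn1 : (1 : ℝ) ≤ n := by exact_mod_cast h1
  have hlog0 : 0 ≤ Real.log n := Real.log_nonneg hn1
  have hlogn : Real.log n ≤ Real.log ((n : ℝ) + 1) := Real.log_le_log (by linarith) (by linarith)
  have h3 : Real.log n ^ 2 ≤ Real.log ((n : ℝ) + 1) ^ 2 := pow_le_pow_left₀ hlog0 hlogn 2
  rw [abs_mul]
  calc |liIncr n| * |liIncr (n + 1)|
      ≤ (C * Real.log n ^ 2) * (C * Real.log ((n : ℝ) + 1) ^ 2) :=
        mul_le_mul hn hn' (abs_nonneg _) (by positivity)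
    _ ≤ (C * Real.log ((n : ℝ) + 1) ^ 2) * (C * Real.log ((n : ℝ) + 1) ^ 2) :=
        mul_le_mul_of_nonneg_right (mul_le_mul_of_nonneg_left h3 hC0.le) (by positivity)
    _ = C ^ 2 * Real.log ((n : ℝ) + 1) ^ 4 := by ring

/-- Under RH, `|Δ_n Δ_{n+1}| ≤ ε (n+1)` for every `ε > 0` and all large `n` (`log⁴ = o(id)`). -/
private theorem abs_incrProd_le_linear_of_rh (hRH : _root_.RiemannHypothesis) {ε : ℝ} (hε : 0 < ε) :
    ∀ᶠ n : ℕ in atTop, |liIncr n * liIncr (n + 1)| ≤ ε * ((n : ℝ) + 1) := by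
  obtain ⟨C, hC0, hC⟩ := abs_incrProd_le_of_rh hRH
  have hlo : ∀ᶠ x : ℝ in atTop, ‖Real.log x ^ 4‖ ≤ ε / C * ‖id x‖ :=
    (Real.isLittleO_pow_log_id_atTop (n := 4)).def (by positivity)
  have ht : Tendsto (fun m : ℕ ↦ (m : ℝ) + 1) atTop atTop :=
    tendsto_atTop_add_const_right _ _ tendsto_natCast_atTop_atTop
  filter_upwards [hC, ht.eventually hlo] with n hn hm
  rw [id_eq, Real.norm_eq_abs, Real.norm_eq_abs, abs_of_nonneg (by positivity),
    abs_of_nonneg (by positivity)] at hm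
  have := mul_le_mul_of_nonneg_left hm hC0.le
  have e : C * (ε / C * ((n : ℝ) + 1)) = ε * ((n : ℝ) + 1) := by
    field_simp
  linarith [e]

/-- **RH ⟹ the Turán determinant is `−λ_{n+1} d_n` up to `O(log⁴ n)`:**
`|T_{n+1} + λ_{n+1} d_n| = |Δ_n Δ_{n+1}| ≤ C log⁴(n+1)` for all large `n`. RH-CONSEQUENCE. -/
theorem abs_turan_add_main_le_of_rh (hRH : _root_.RiemannHypothesis) :
    ∃ C : ℝ, 0 < C ∧ ∀ᶠ n : ℕ in atTop,
      |(keiperLiCoeff (n + 1) ^ 2 - keiperLiCoeff n * keiperLiCoeff (n + 2))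
          + keiperLiCoeff (n + 1) * (keiperLiCoeff (n + 2) - 2 * keiperLiCoeff (n + 1) + keiperLiCoeff n)|
        ≤ C * Real.log ((n : ℝ) + 1) ^ 4 := by
  obtain ⟨C, hC0, hC⟩ := abs_incrProd_le_of_rh hRH
  refine ⟨C, hC0, ?_⟩
  filter_upwards [hC] with n hn
  have hid := turan_identity (keiperLiCoeff n) (keiperLiCoeff (n + 1)) (keiperLiCoeff (n + 2))
  have e : (keiperLiCoeff (n + 1) ^ 2 - keiperLiCoeff n * keiperLiCoeff (n + 2))
      + keiperLiCoeff (n + 1) * (keiperLiCoeff (n + 2) - 2 * keiperLiCoeff (n + 1) + keiperLiCoeff n)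
      = liIncr n * liIncr (n + 1) := by
    simp only [liIncr, show n + 1 + 1 = n + 2 from rfl]
    ring
  rw [e]
  exact hn

/-- **RH ⟹ `T_{n+1}/λ_{n+1} + d_n → 0`:** the normalised Turán determinant IS minus the second difference, asymptotically
(`|T_{n+1}/λ_{n+1} + d_n| ≤ 2C log⁴(n+1)/(n+1)`). RH-CONSEQUENCE. -/
theorem tendsto_turan_ratio_add_secondDiff_of_rh (hRH : _root_.RiemannHypothesis) :
    Tendsto (fun n : ℕ ↦
      (keiperLiCoeff (n + 1) ^ 2 - keiperLiCoeff n * keiperLiCoeff (n + 2)) / keiperLiCoeff (n + 1)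
        + (keiperLiCoeff (n + 2) - 2 * keiperLiCoeff (n + 1) + keiperLiCoeff n)) atTop (𝓝 0) := by
  obtain ⟨N₁, hN₁⟩ := li_lower_of_rh hRH
  obtain ⟨C, hC0, hC⟩ := abs_incrProd_le_of_rh hRH
  have hg : Tendsto (fun n : ℕ ↦ 2 * C * (Real.log ((n : ℝ) + 1) ^ 4 / ((n : ℝ) + 1))) atTop (𝓝 0) := by
    have h1 : Tendsto (fun x : ℝ ↦ Real.log x ^ 4 / x) atTop (𝓝 0) :=
      (Real.isLittleO_pow_log_id_atTop (n := 4)).tendsto_div_nhds_zero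
    have h2 : Tendsto (fun m : ℕ ↦ (m : ℝ) + 1) atTop atTop :=
      tendsto_atTop_add_const_right _ _ tendsto_natCast_atTop_atTop
    simpa using (h1.comp h2).const_mul (2 * C)
  refine squeeze_zero_norm' ?_ hg
  filter_upwards [hC, eventually_ge_atTop N₁] with n hn hN
  have hlam := hN₁ (n + 1) (by omega)
  push_cast at hlam
  have hn0 : (0 : ℝ) ≤ n := Nat.cast_nonneg n
  have hpos : 0 < keiperLiCoeff (n + 1) := by linarith
  have hid := turan_identity (keiperLiCoeff n) (keiperLiCoeff (n + 1)) (keiperLiCoeff (n + 2))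
  have e : (keiperLiCoeff (n + 1) ^ 2 - keiperLiCoeff n * keiperLiCoeff (n + 2)) / keiperLiCoeff (n + 1)
      + (keiperLiCoeff (n + 2) - 2 * keiperLiCoeff (n + 1) + keiperLiCoeff n)
      = liIncr n * liIncr (n + 1) / keiperLiCoeff (n + 1) := by
    simp only [liIncr, show n + 1 + 1 = n + 2 from rfl]
    field_simp
    ring
  rw [e, Real.norm_eq_abs, abs_div, abs_of_pos hpos]
  calc |liIncr n * liIncr (n + 1)| / keiperLiCoeff (n + 1)
      ≤ C * Real.log ((n : ℝ) + 1) ^ 4 / keiperLiCoeff (n + 1) := div_le_div_of_nonneg_right hn hpos.le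
    _ ≤ C * Real.log ((n : ℝ) + 1) ^ 4 / (((n : ℝ) + 1) / 2) :=
        div_le_div_of_nonneg_left (by positivity) (by positivity) hlam
    _ = 2 * C * (Real.log ((n : ℝ) + 1) ^ 4 / ((n : ℝ) + 1)) := by
        field_simp

/-- **RH ⟹ the Turán / log-concavity inequality FAILS on a SYNDETIC set:** there are `L, n₀` with every window
`[N, N+L)`, `N ≥ n₀`, containing an `n` with `λ_{n+1}² < λ_n λ_{n+2}`.  (At the tree's window points with `d_n ≥ η`:
`T_{n+1} = −λ_{n+1} d_n + Δ_nΔ_{n+1} ≤ −η(n+1)/2 + η(n+1)/4 < 0`.)  RH-CONSEQUENCE; upgrades SketchG10's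
`turanFail_io_of_rh`. -/
theorem turanFail_syndetic_of_rh (hRH : _root_.RiemannHypothesis) :
    ∃ L n₀ : ℕ, ∀ N : ℕ, n₀ ≤ N →
      ∃ n ∈ Finset.Ico N (N + L), keiperLiCoeff (n + 1) ^ 2 < keiperLiCoeff n * keiperLiCoeff (n + 2) := by
  obtain ⟨η, hη, L, hwin⟩ := liSecondDiff_two_signs_of_rh hRH
  obtain ⟨N₁, hN₁⟩ := li_lower_of_rh hRH
  obtain ⟨N₂, hN₂⟩ := eventually_atTop.1
    (abs_incrProd_le_linear_of_rh hRH (by positivity : 0 < η / 4))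
  refine ⟨L, N₁ + N₂ + 1, fun N hN ↦ ?_⟩
  obtain ⟨⟨n, hnI, hdn⟩, -⟩ := hwin N (by omega)
  refine ⟨n, hnI, ?_⟩
  have hnN : N ≤ n := (Finset.mem_Ico.1 hnI).1
  have hlam := hN₁ (n + 1) (by omega)
  push_cast at hlam
  have hsmall := abs_le.1 (hN₂ n (by omega))
  have hn0 : (0 : ℝ) ≤ n := Nat.cast_nonneg n
  have hid := turan_identity (keiperLiCoeff n) (keiperLiCoeff (n + 1)) (keiperLiCoeff (n + 2))
  have e : liIncr n * liIncr (n + 1)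
      = (keiperLiCoeff (n + 1) - keiperLiCoeff n) * (keiperLiCoeff (n + 2) - keiperLiCoeff (n + 1)) := by
    simp only [liIncr, show n + 1 + 1 = n + 2 from rfl]
  rw [e] at hsmall
  have hmain : η * (((n : ℝ) + 1) / 2) ≤
      keiperLiCoeff (n + 1) * (keiperLiCoeff (n + 2) - 2 * keiperLiCoeff (n + 1) + keiperLiCoeff n) := by
    have := mul_le_mul hdn hlam (by positivity) (by linarith)
    linarith
  nlinarith [hsmall.2, hmain, hid]

/-- Hence (with SketchG10 §2, re-derived here in two lines from the same inputs) **under RH BOTH Turán signs are syndetic**: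
`T > 0` syndetically (at `d_n ≤ −η`: `T_{n+1} ≥ η(n+1)/2 − η(n+1)/4 > 0`) and `T < 0` syndetically. RH-CONSEQUENCE. -/
theorem turan_both_signs_syndetic_of_rh (hRH : _root_.RiemannHypothesis) :
    ∃ L n₀ : ℕ, ∀ N : ℕ, n₀ ≤ N →
      (∃ n ∈ Finset.Ico N (N + L), keiperLiCoeff n * keiperLiCoeff (n + 2) < keiperLiCoeff (n + 1) ^ 2) ∧
      (∃ n ∈ Finset.Ico N (N + L), keiperLiCoeff (n + 1) ^ 2 < keiperLiCoeff n * keiperLiCoeff (n + 2)) := by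
  obtain ⟨η, hη, L, hwin⟩ := liSecondDiff_two_signs_of_rh hRH
  obtain ⟨N₁, hN₁⟩ := li_lower_of_rh hRH
  obtain ⟨N₂, hN₂⟩ := eventually_atTop.1
    (abs_incrProd_le_linear_of_rh hRH (by positivity : 0 < η / 4))
  refine ⟨L, N₁ + N₂ + 1, fun N hN ↦ ⟨?_, ?_⟩⟩
  · obtain ⟨-, ⟨n, hnI, hdn⟩⟩ := hwin N (by omega)
    refine ⟨n, hnI, ?_⟩
    have hnN : N ≤ n := (Finset.mem_Ico.1 hnI).1
    have hlam := hN₁ (n + 1) (by omega)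
    push_cast at hlam
    have hsmall := abs_le.1 (hN₂ n (by omega))
    have hn0 : (0 : ℝ) ≤ n := Nat.cast_nonneg n
    have hid := turan_identity (keiperLiCoeff n) (keiperLiCoeff (n + 1)) (keiperLiCoeff (n + 2))
    have e : liIncr n * liIncr (n + 1)
        = (keiperLiCoeff (n + 1) - keiperLiCoeff n) * (keiperLiCoeff (n + 2) - keiperLiCoeff (n + 1)) := by
      simp only [liIncr, show n + 1 + 1 = n + 2 from rfl]
    rw [e] at hsmall
    have hmain : η * (((n : ℝ) + 1) / 2) ≤
        -(keiperLiCoeff (n + 1) * (keiperLiCoeff (n + 2) - 2 * keiperLiCoeff (n + 1) + keiperLiCoeff n)) := by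
      have := mul_le_mul (show η ≤ -(keiperLiCoeff (n + 2) - 2 * keiperLiCoeff (n + 1) + keiperLiCoeff n) by
        linarith) hlam (by positivity) (by linarith)
      linarith
    nlinarith [hsmall.1, hmain, hid]
  · obtain ⟨⟨n, hnI, hdn⟩, -⟩ := hwin N (by omega)
    refine ⟨n, hnI, ?_⟩
    have hnN : N ≤ n := (Finset.mem_Ico.1 hnI).1
    have hlam := hN₁ (n + 1) (by omega)
    push_cast at hlam
    have hsmall := abs_le.1 (hN₂ n (by omega))
    have hn0 : (0 : ℝ) ≤ n := Nat.cast_nonneg n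
    have hid := turan_identity (keiperLiCoeff n) (keiperLiCoeff (n + 1)) (keiperLiCoeff (n + 2))
    have e : liIncr n * liIncr (n + 1)
        = (keiperLiCoeff (n + 1) - keiperLiCoeff n) * (keiperLiCoeff (n + 2) - keiperLiCoeff (n + 1)) := by
      simp only [liIncr, show n + 1 + 1 = n + 2 from rfl]
    rw [e] at hsmall
    have hmain : η * (((n : ℝ) + 1) / 2) ≤
        keiperLiCoeff (n + 1) * (keiperLiCoeff (n + 2) - 2 * keiperLiCoeff (n + 1) + keiperLiCoeff n) := by
      have := mul_le_mul hdn hlam (by positivity) (by linarith)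
      linarith
    nlinarith [hsmall.2, hmain, hid]

/-- **Under RH both Turán sign sets have POSITIVE LOWER DENSITY:** there is `L ≥ 1` with
`#{n < N : λ_nλ_{n+2} < λ_{n+1}²} ≥ N/L` and `#{n < N : λ_{n+1}² < λ_nλ_{n+2}} ≥ N/L` for every `N` (ℕ-division).
RH-CONSEQUENCE (syndetic ⟹ lower density `≥ 1/L`, by the tree's pure counting helper
`LiDifferenceOrderLaw.card_filter_range_ge_div`). -/
theorem turan_sign_sets_lower_density_of_rh (hRH : _root_.RiemannHypothesis) :
    ∃ L : ℕ, 1 ≤ L ∧ ∀ N : ℕ,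
      N / L ≤ ((Finset.range N).filter
        (fun n ↦ keiperLiCoeff n * keiperLiCoeff (n + 2) < keiperLiCoeff (n + 1) ^ 2)).card ∧
      N / L ≤ ((Finset.range N).filter
        (fun n ↦ keiperLiCoeff (n + 1) ^ 2 < keiperLiCoeff n * keiperLiCoeff (n + 2))).card := by
  obtain ⟨L, n₀, h⟩ := turan_both_signs_syndetic_of_rh hRH
  have hwin : ∀ a : ℕ,
      (∃ n ∈ Finset.Ico a (a + (n₀ + L)),
        keiperLiCoeff n * keiperLiCoeff (n + 2) < keiperLiCoeff (n + 1) ^ 2) ∧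
      (∃ n ∈ Finset.Ico a (a + (n₀ + L)),
        keiperLiCoeff (n + 1) ^ 2 < keiperLiCoeff n * keiperLiCoeff (n + 2)) := by
    intro a
    obtain ⟨⟨n, hn, h1⟩, ⟨m, hm, h2⟩⟩ := h (a + n₀) (by omega)
    rw [Finset.mem_Ico] at hn hm
    exact ⟨⟨n, Finset.mem_Ico.2 ⟨by omega, by omega⟩, h1⟩,
      ⟨m, Finset.mem_Ico.2 ⟨by omega, by omega⟩, h2⟩⟩
  have hL1 : 1 ≤ n₀ + L := by
    obtain ⟨⟨n, hn, -⟩, -⟩ := hwin 0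
    rw [Finset.mem_Ico] at hn
    omega
  exact ⟨n₀ + L, hL1, fun N ↦
    ⟨LiDifferenceOrderLaw.card_filter_range_ge_div (fun a ↦ (hwin a).1) N,
      LiDifferenceOrderLaw.card_filter_range_ge_div (fun a ↦ (hwin a).2) N⟩⟩

end Summit.RiemannHypothesis.RiemannHypothesis.Theorems.Splittings.LiIncrEnvelope

end
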